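import Literature.Combinatorics.StablePolynomials.RealStableMultiaffineCriterion
import HarnessLib

/-!
# Proper position, the multivariate Hermite–Biehler lemma and the Hermite–Kakeya–Obreschkoff theorem
# (Borcea–Brändén 2009, §1: Definition 1.1, Lemma 1.8, Theorem 1.9, Corollary 1.10)

Topic `Literature/Combinatorics/StablePolynomials`, namespace `Literature.Combinatorics.StablePolynomials`
(vocabulary of `Basic.lean`: `IsUpperHalfPlaneStable p :↔ ∀ z ∈ ℋⁿ, p(z) ≠ 0` — Borcea–Brändén's `𝓗ₙ(ℂ)`, the
zero polynomial excluded — and `IsRealStable q :↔ IsUpperHalfPlaneStable (map (algebraMap ℝ ℂ) q)` — their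
`𝓗ₙ(ℝ)`); lane `lit-hodgefound` (Track 2 foundations library), seat p16, generation 31 (row g31-#8). The tree
used "proper position" only inside docstrings (`RealStableMultiaffineCriterion.lean`: "The tree does not contain
the multivariate Hermite–Biehler and Obreschkoff theorems"; `PartialSymmetrization.lean`); this file supplies the
definition and the two theorems in Borcea–Brändén's formulation, for any finite set of variables (the univariate
case is `σ = Unit`).

## Source (verbatim) — J. Borcea, P. Brändén, *The Lee–Yang and Pólya–Schur programs. I. Linear operators
## preserving stability*, Invent. Math. 177 (2009) 541–569 [BorceaBranden2009] (held: `paper:arxiv-0809.0401`,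
## pp. 5–7 of the arXiv text)

§1: "we will […] refer to `H`-stable multivariate polynomials simply as stable polynomials […]. A stable polynomial
with all real coefficients is called real stable. Clearly, a univariate real polynomial is stable if and only if
all its zeros are real. We denote the sets of stable, respectively real stable polynomials in `n` variables by
`𝓗ₙ(ℂ)` and `𝓗ₙ(ℝ)`". **Definition 1.1.** "Two polynomials `f, g ∈ ℝ[z₁,…,zₙ]` are in proper position, denoted
`f ≪ g`, if `g + if ∈ 𝓗ₙ(ℂ)`." ("By the Hermite–Biehler theorem […] in the univariate case the relation `f ≪ g`
is equivalent to saying that `f` and `g` are real-rooted (or identically zero), their zeros interlace and their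
Wronskian `W[f,g] := f'g − fg'` is non-positive on the whole of `ℝ`.")

**Lemma 1.8.** "Let `f, g ∈ ℝ[z₁,…,zₙ] ∖ {0}`, set `h = f + ig` and suppose that `f` and `g` are not constant
multiples of each other. The following are equivalent: (1) `h ∈ 𝓗ₙ(ℂ)`, that is, `g ≪ f`; (2) `|h(z)| > |h(z̄)|`
for all `z ∈ ℂⁿ` with `Im(zⱼ) > 0`, `1 ≤ j ≤ n`; (3) `f + z_{n+1} g ∈ 𝓗_{n+1}(ℝ)`; (4) `f, g ∈ 𝓗ₙ(ℝ)` and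
`Im(f(z)/g(z)) ≥ 0` whenever `Im(zⱼ) > 0`, `1 ≤ j ≤ n`; (5) […]." Proof of (1) ⇒ (2): "The polynomial
`p(t) = h(α + tβ)` is stable so we may write it as `p(t) = C ∏ⱼ (t − ζⱼ)` where `Im(ζⱼ) ≤ 0`. Note that for all
`j` one has `|i − ζⱼ| ≥ |−i − ζⱼ|` […]. Hence `|f(w) + ig(w)| = |h(w)| ≥ |h(w̄)| = |f(w) − ig(w)|`", whence
"`Im(f(w)/g(w)) ≥ 0`. Now if `q(z_{n+1}) = 0` then `f(w)/g(w) + z_{n+1} = 0` and thus `Im(z_{n+1}) ≤ 0`."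

**Theorem 1.9** (Hermite–Kakeya–Obreschkoff, several variables; first proved in [BBS3]). "Let `f, g ∈ ℝ[z₁,…,zₙ]`.
All non-zero polynomials in the space `{αf + βg : α, β ∈ ℝ}` are stable if and only if either `f = g ≡ 0`,
`f ≪ g` or `g ≪ f`. Moreover, if `g ≪ f` then `Wⱼ[g,f](x) ≤ 0` for all `x ∈ ℝⁿ` and `1 ≤ j ≤ n`, and if `f ≪ g`
then `Wⱼ[g,f](x) ≥ 0` for all `x ∈ ℝⁿ` and `1 ≤ j ≤ n`" (Definition 1.2: `Wⱼ[g,f] = ∂ⱼg · f − g · ∂ⱼf`). Proof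
of "only if": "there exist `z, w ∈ {Im ζ > 0}ⁿ` for which `Im(f(z)/g(z)) > 0` and `Im(f(w)/g(w)) < 0`. By
connectivity there is a number `v` […] for which `f(v)/g(v) = a ∈ ℝ ∖ {0}`. It follows that `f − ag` is
identically zero". **Corollary 1.10.** "If `f, g ∈ ℝ[z₁,…,zₙ] ∖ {0}` are real stable polynomials such that
`f ≪ g` and `g ≪ f` then `f = αg` for some `α ∈ ℝ`."

## What is here (all for `f g : MvPolynomial σ ℝ`; `F, G` denote their complexifications)

* §1 **`IsProperPosition f g`** (Definition 1.1: `g + if` is stable) and its unfoldings; `0 ≪ g ↔ g` real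
  stable, `f ≪ 0 ↔ f` real stable, `f ≪ g → g ≪ −f`, `f ≪ g → −f ≪ −g`, `f ≪ g → ¬(f = 0 ∧ g = 0)`.
* §2 The modulus inequality of the proof of Lemma 1.8: `|p(t̄)| ≤ |p(t)|` on `H` for a univariate `p ∈ ℂ[t]`
  without zeros in `H` (`norm_eval_conj_le_of_forall_eval_ne_zero`), and Lemma 1.8 (1) ⇒ (2) in the weak form
  `|h(z̄)| ≤ |h(z)|` valid for every stable `h` (`IsUpperHalfPlaneStable.norm_eval_conj_le`).
* §3 Lemma 1.8 (1) ⇒ (4): `f ≪ g ⇒ Im(F(z)·conj G(z)) ≤ 0`, equivalently `Im(G(z)/F(z)) ≥ 0` and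
  `Im(F(z)/G(z)) ≤ 0`, on `ℋⁿ` (`IsProperPosition.im_eval_mul_conj_nonpos`, `.im_div_nonneg`, `.im_div_nonpos`);
  the open-mapping step "a real value of `F/G` at a point of `ℋⁿ` where `Im(F·conj G)` keeps a sign forces
  `f = c·g`" (`eq_C_mul_of_im_eval_mul_conj_nonpos` / `_nonneg`); `f ≪ g ⇒ f, g ∈ 𝓗ₙ(ℝ) ∪ {0}`; and the
  characterisation **`isProperPosition_iff`**: `f ≪ g ↔ (f = 0 ∨ f real stable) ∧ (g = 0 ∨ g real stable) ∧
  ¬(f = g = 0) ∧ ∀ z ∈ ℋⁿ, Im(F(z)·conj G(z)) ≤ 0` — Lemma 1.8 (1) ⇔ (4) with the degenerate cases made explicit.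
* §4 Lemma 1.8 (1) ⇔ (3): `f ≪ g ↔ g + z_{new} f ∈ 𝓗_{n+1}(ℝ)` (`isProperPosition_iff_isRealStable_add_X_mul`,
  index type `Option σ`).
* §5 **Theorem 1.9** (`isRealStable_pencil_iff`): all nonzero `af + bg` real stable `↔ f = g = 0 ∨ f ≪ g ∨ g ≪ f`,
  with the "if" half `IsProperPosition.pencil`; **Corollary 1.10** (`IsProperPosition.exists_eq_C_mul`).
* §6 Theorem 1.9, "moreover": `f ≪ g ⇒ Wⱼ[g,f](x) = (∂ⱼg·f − g·∂ⱼf)(x) ≥ 0` and `g ≪ f ⇒ Wⱼ[g,f](x) ≤ 0` for real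
  `x` (`IsProperPosition.wronskian_nonneg`, `.wronskian_nonpos`), through the directional form
  `∑ⱼ vⱼ Wⱼ[g,f](x) ≥ 0` for `v ∈ ℝⁿ_{>0}` (`IsProperPosition.sum_mul_wronskian_nonneg`).
* §7 Lemma 1.8 (1) ⇔ (5) in line form (`isProperPosition_iff_line`, through the tree's Lemma 1.5
  `isUpperHalfPlaneStable_iff_line`); Lemma 1.8 (1) ⇒ (2) in the printed strict form `|h(z̄)| < |h(z)|` for
  `g ≠ 0`, `f ∉ ℝg` (`IsProperPosition.norm_eval_conj_lt`); and **Brändén 2007, Corollary 5.5** as a `TFAE`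
  (`isProperPosition_tfae`: `g ≪ h` ⇔ `h + z_{n+1} g` real stable ⇔ pencil real stable and all
  `∂ⱼh·g − h·∂ⱼg ≥ 0` on `ℝⁿ`), whose (c) ⇒ (a) is the tree's `eval_add_mul_eval_ne_zero`.

Not here: the univariate root-interlacing reformulation of `f ≪ g`.

## Proof route and deviations from the printed proofs

Lemma 1.8 is proved as printed ((1) ⇒ (2) by restriction to the line `t ↦ Re z + t Im z` — the tree's
`linePoly` — and the factorisation of a univariate stable polynomial; (2) ⇒ (4), (4) ⇒ (3) ⇒ (1) by the printed
one-line computations). The printed proofs obtain "`f, g ∈ 𝓗ₙ(ℝ)`" and the "if" half of Theorem 1.9 from (3) by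
real specialisation (Lemma 1.7 (1), a Hurwitz-continuity statement); here both come instead from the **open
mapping theorem** for the analytic function `F/G` on `ℂⁿ` (Mathlib `AnalyticAt.eventually_constant_or_nhds_le_map_nhds`)
and the identity principle (`AnalyticOnNhd.eq_of_eventuallyEq`, `MvPolynomial.funext`): where `Im(F·conj G) ≤ 0`
near a point of `ℋⁿ` at which `F/G` is real, `F/G` is locally — hence globally — constant. The "only if" half of
Theorem 1.9 is the printed connectivity argument (`IsPreconnected.intermediate_value` on the convex `ℋⁿ`). The
Wronskian inequalities are obtained from `Im(F·conj G)(x + iyv) ≤ 0` (`y > 0`, `v ∈ ℝⁿ_{>0}`) by differentiating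
at `y = 0` (the printed proof expands `f/g` along `x + teⱼ` instead and uses density of `{g ≠ 0}`).

## References

* [BorceaBranden2009] J. Borcea, P. Brändén, *The Lee–Yang and Pólya–Schur programs. I. Linear operators
  preserving stability*, Invent. Math. 177 (2009) 541–569, arXiv:0809.0401 — §1: Def. 1.1, Lemma 1.8, Thm. 1.9,
  Cor. 1.10 and their proofs.
* [Wagner2011] D. G. Wagner, *Multivariate stable polynomials: theory and applications*, Bull. AMS 48 (2011),
  §2.3 (the univariate Hermite–Biehler and Hermite–Kakeya–Obreschkoff theorems, proper position `f ≪ g`).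
* [Branden2007] P. Brändén, *Polynomials with the half-plane property and matroid theory*, Adv. Math. 216 (2007),
  §5: proper position in several variables (source of the tree's `linePoly`) and Corollary 5.5 ("Let
  `f = h + ig ≠ 0` […]. Then the following are equivalent. (a) `f = h + ig` is stable, (b) `h + z_{n+1} g` is real
  stable, (c) all nonzero polynomials in the pencil `{αh + βg : α, β ∈ ℝ}` are real stable and
  `∂h/∂zⱼ(x)·g(x) − h(x)·∂g/∂zⱼ(x) ≥ 0` for all `1 ≤ j ≤ n` and `x ∈ ℝⁿ`").
-/

noncomputable section

open scoped BigOperators Topology Polynomial ComplexConjugate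
open MvPolynomial Filter Set

namespace Literature.Combinatorics.StablePolynomials

variable {σ : Type*}

/-! ## §1 Proper position (Definition 1.1) -/

/-- **Proper position** (Borcea–Brändén 2009, Definition 1.1): two real polynomials `f, g ∈ ℝ[z₁,…,zₙ]` are in
proper position, `f ≪ g`, if `g + i f` is stable, i.e. `g(z) + i f(z) ≠ 0` for every `z ∈ ℋⁿ`.
[cite: BorceaBranden2009, §1 Definition 1.1] -/
def IsProperPosition (f g : MvPolynomial σ ℝ) : Prop :=
  IsUpperHalfPlaneStable (map (algebraMap ℝ ℂ) g + C Complex.I * map (algebraMap ℝ ℂ) f)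

/-- Unfolding `IsProperPosition`: `g(z) + i f(z) ≠ 0` on `ℋⁿ`. [cite: BorceaBranden2009, §1 Definition 1.1] -/
theorem isProperPosition_iff_forall (f g : MvPolynomial σ ℝ) :
    IsProperPosition f g ↔ ∀ z : σ → ℂ, (∀ i, 0 < (z i).im) →
      eval z (map (algebraMap ℝ ℂ) g) + Complex.I * eval z (map (algebraMap ℝ ℂ) f) ≠ 0 := by
  simp only [IsProperPosition, IsUpperHalfPlaneStable, map_add, map_mul, eval_C]

/-- `0 ≪ g` iff `g` is real stable. [cite: BorceaBranden2009, §1 Definition 1.1] -/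
theorem isProperPosition_zero_left_iff (g : MvPolynomial σ ℝ) : IsProperPosition 0 g ↔ IsRealStable g := by
  simp [IsProperPosition, IsRealStable]

/-- `f ≪ 0` iff `f` is real stable (`i f` is stable iff `f` is). [cite: BorceaBranden2009, §1 Definition 1.1] -/
theorem isProperPosition_zero_right_iff (f : MvPolynomial σ ℝ) : IsProperPosition f 0 ↔ IsRealStable f := by
  rw [IsProperPosition, map_zero, zero_add, IsRealStable, isUpperHalfPlaneStable_mul_iff]
  exact ⟨fun h => h.2, fun h => ⟨isUpperHalfPlaneStable_C Complex.I_ne_zero, h⟩⟩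

/-- `f ≪ g → g ≪ -f`: `(-f) + i g = i (g + i f)`. [cite: BorceaBranden2009, §1 (proof of Corollary 1.10,
"`f ≪ g` and `f ≪ -g`")] -/
theorem IsProperPosition.swap_neg {f g : MvPolynomial σ ℝ} (h : IsProperPosition f g) :
    IsProperPosition g (-f) := by
  have hI : (C Complex.I : MvPolynomial σ ℂ) * C Complex.I = -1 := by
    rw [← C_mul, Complex.I_mul_I, C_neg, C_1]
  have : map (algebraMap ℝ ℂ) (-f) + C Complex.I * map (algebraMap ℝ ℂ) g =
      C Complex.I * (map (algebraMap ℝ ℂ) g + C Complex.I * map (algebraMap ℝ ℂ) f) := by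
    rw [mul_add, ← mul_assoc, hI, map_neg]
    ring
  unfold IsProperPosition
  rw [this]
  exact (isUpperHalfPlaneStable_C Complex.I_ne_zero).mul h

/-- `f ≪ g → (-f) ≪ (-g)`: `(-g) + i(-f) = -(g + if)` (twice `swap_neg`). [cite: BorceaBranden2009, §1 Definition 1.1] -/
theorem IsProperPosition.neg {f g : MvPolynomial σ ℝ} (h : IsProperPosition f g) : IsProperPosition (-f) (-g) :=
  h.swap_neg.swap_neg

/-- `f ≪ g` excludes `f = g = 0` (the zero polynomial is not stable). [cite: BorceaBranden2009, §1 Theorem 1.9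
("either `f = g ≡ 0`, `f ≪ g` or `g ≪ f`")] -/
theorem IsProperPosition.not_and_eq_zero {f g : MvPolynomial σ ℝ} (h : IsProperPosition f g) :
    ¬(f = 0 ∧ g = 0) := by
  rintro ⟨rfl, rfl⟩
  exact h (fun _ => Complex.I) (fun _ => by simp) (by simp)

/-! ## §2 The modulus inequality `|h(z̄)| ≤ |h(z)|` -/

/-- `|t̄ - ξ| ≤ |t - ξ|` for `Im t ≥ 0 ≥ Im ξ`. [cite: BorceaBranden2009, §1 proof of Lemma 1.8
("`|i − ζⱼ| ≥ |−i − ζⱼ|`")] -/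
private theorem normSq_conj_sub_le {t ξ : ℂ} (ht : 0 ≤ t.im) (hξ : ξ.im ≤ 0) :
    Complex.normSq (conj t - ξ) ≤ Complex.normSq (t - ξ) := by
  simp only [Complex.normSq_apply, Complex.sub_re, Complex.sub_im, Complex.conj_re, Complex.conj_im]
  nlinarith [mul_nonneg ht (neg_nonneg.2 hξ)]

/-- **`|p(t̄)| ≤ |p(t)|` on `H`** for a univariate `p ∈ ℂ[t]` without zeros in the open upper half-plane: write
`p(t) = C ∏ (t − ζⱼ)` with `Im ζⱼ ≤ 0` and use `|t̄ − ζⱼ| ≤ |t − ζⱼ|`.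
[cite: BorceaBranden2009, §1 proof of Lemma 1.8 ((1) ⇒ (2))] -/
theorem norm_eval_conj_le_of_forall_eval_ne_zero {p : ℂ[X]} (hp : ∀ t : ℂ, 0 < t.im → p.eval t ≠ 0)
    {t : ℂ} (ht : 0 < t.im) : ‖p.eval (conj t)‖ ≤ ‖p.eval t‖ := by
  have hroots : ∀ ξ ∈ p.roots, ξ.im ≤ 0 := fun ξ hξ =>
    not_lt.1 fun hlt => hp ξ hlt (Polynomial.mem_roots'.1 hξ).2
  have key : Complex.normSq (p.eval (conj t)) ≤ Complex.normSq (p.eval t) := by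
    rw [(IsAlgClosed.splits p).eval_eq_prod_roots (conj t), (IsAlgClosed.splits p).eval_eq_prod_roots t,
      map_mul, map_mul, map_multiset_prod, map_multiset_prod, Multiset.map_map, Multiset.map_map]
    refine mul_le_mul_of_nonneg_left ?_ (Complex.normSq_nonneg _)
    exact Multiset.prod_map_le_prod_map₀ _ _ (fun ξ _ => Complex.normSq_nonneg _)
      fun ξ hξ => normSq_conj_sub_le ht.le (hroots ξ hξ)
  rwa [Complex.normSq_eq_norm_sq, Complex.normSq_eq_norm_sq, sq_le_sq₀ (norm_nonneg _) (norm_nonneg _)] at key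

/-- `Im (Re zⱼ + t Im zⱼ) = Im t · Im zⱼ`. [cite: BorceaBranden2009, §1 proof of Lemma 1.8 (the line `α + tβ`)] -/
private theorem im_line_point (z : σ → ℂ) (t : ℂ) (j : σ) :
    (((z j).re : ℂ) + t * ((z j).im : ℂ)).im = t.im * (z j).im := by
  simp [Complex.add_im, Complex.mul_im]

/-- At `t = i` the line `Re z + t Im z` passes through `z`. [cite: BorceaBranden2009, §1 proof of Lemma 1.8] -/
private theorem line_point_I (z : σ → ℂ) : (fun j => ((z j).re : ℂ) + Complex.I * ((z j).im : ℂ)) = z := by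
  funext j
  rw [mul_comm]
  exact Complex.re_add_im (z j)

/-- At `t = -i` the line `Re z + t Im z` passes through `z̄`. [cite: BorceaBranden2009, §1 proof of Lemma 1.8] -/
private theorem line_point_neg_I (z : σ → ℂ) :
    (fun j => ((z j).re : ℂ) + -Complex.I * ((z j).im : ℂ)) = fun j => conj (z j) := by
  funext j
  apply Complex.ext <;> simp

/-- **Lemma 1.8, (1) ⇒ (2) (weak form, valid for every stable polynomial)**: if `h ∈ ℂ[z₁,…,zₙ]` is stable then
`|h(z̄)| ≤ |h(z)|` for all `z ∈ ℋⁿ`. (Restrict to the line `t ↦ Re z + t Im z`, stable as a polynomial in `t`,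
and evaluate at `t = ± i`.) [cite: BorceaBranden2009, §1 Lemma 1.8 ((1) ⇒ (2)) and its proof] -/
theorem IsUpperHalfPlaneStable.norm_eval_conj_le {h : MvPolynomial σ ℂ} (hh : IsUpperHalfPlaneStable h)
    {z : σ → ℂ} (hz : ∀ i, 0 < (z i).im) :
    ‖eval (fun i => conj (z i)) h‖ ≤ ‖eval z h‖ := by
  set P := linePoly h (fun j => ((z j).re : ℂ)) (fun j => ((z j).im : ℂ)) with hP
  have hPev : ∀ t, P.eval t = eval (fun j => ((z j).re : ℂ) + t * ((z j).im : ℂ)) h := fun t =>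
    eval_linePoly h _ _ t
  have hPst : ∀ t : ℂ, 0 < t.im → P.eval t ≠ 0 := fun t ht => by
    rw [hPev]
    exact hh _ fun j => by rw [im_line_point]; exact mul_pos ht (hz j)
  have key := norm_eval_conj_le_of_forall_eval_ne_zero hPst (t := Complex.I) (by simp)
  rwa [hPev, hPev, Complex.conj_I, line_point_I, line_point_neg_I] at key

/-! ## §3 Lemma 1.8, (1) ⇔ (4): the half-plane characterisation of proper position -/

section HalfPlane

variable {f g : MvPolynomial σ ℝ}

/-- Evaluation of a real polynomial commutes with complex conjugation. [cite: BorceaBranden2009, §1 proof of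
Lemma 1.8 ("`|h(w̄)| = |conj h(w̄)| = |f(w) − ig(w)|`")] -/
theorem conj_eval_map_eq_eval_conj (q : MvPolynomial σ ℝ) (z : σ → ℂ) :
    conj (eval z (map (algebraMap ℝ ℂ) q)) = eval (fun i => conj (z i)) (map (algebraMap ℝ ℂ) q) := by
  induction q using MvPolynomial.induction_on with
  | C a => simp [Complex.conj_ofReal]
  | add p q hp hq => simp only [map_add, hp, hq]
  | mul_X p i hp => simp only [map_mul, map_X, eval_X, hp]

/-- `Im (a / b) = Im (a · b̄) / |b|²`. [cite: BorceaBranden2009, §1 proof of Lemma 1.8] -/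
private theorem im_div_eq (a b : ℂ) : (a / b).im = (a * conj b).im / Complex.normSq b := by
  rw [Complex.div_im, Complex.mul_im, Complex.conj_re, Complex.conj_im]
  ring

/-- `Im (b · ā) = - Im (a · b̄)`. [cite: BorceaBranden2009, §1 proof of Lemma 1.8] -/
private theorem im_mul_conj_swap (a b : ℂ) : (b * conj a).im = -(a * conj b).im := by
  simp only [Complex.mul_im, Complex.conj_re, Complex.conj_im]
  ring

/-- **Lemma 1.8, (1) ⇒ (4), half-plane form (Hermite–Biehler necessity)**: if `f ≪ g` then
`Im (f(z) · conj g(z)) ≤ 0` for every `z ∈ ℋⁿ` — from `|g(z) + if(z)| ≥ |g(z̄) + if(z̄)| = |g(z) − if(z)|`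
(conjugate). [cite: BorceaBranden2009, §1 Lemma 1.8 ((1) ⇒ (4)) and its proof] -/
theorem IsProperPosition.im_eval_mul_conj_nonpos (h : IsProperPosition f g) {z : σ → ℂ}
    (hz : ∀ i, 0 < (z i).im) :
    (eval z (map (algebraMap ℝ ℂ) f) * conj (eval z (map (algebraMap ℝ ℂ) g))).im ≤ 0 := by
  have key := IsUpperHalfPlaneStable.norm_eval_conj_le h hz
  rw [map_add, map_mul, eval_C, map_add, map_mul, eval_C, ← conj_eval_map_eq_eval_conj,
    ← conj_eval_map_eq_eval_conj] at key
  set a := eval z (map (algebraMap ℝ ℂ) g)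
  set b := eval z (map (algebraMap ℝ ℂ) f)
  have key2 : Complex.normSq (conj a + Complex.I * conj b) ≤ Complex.normSq (a + Complex.I * b) := by
    rw [Complex.normSq_eq_norm_sq, Complex.normSq_eq_norm_sq]
    exact pow_le_pow_left₀ (norm_nonneg _) key 2
  have hid : Complex.normSq (a + Complex.I * b) - Complex.normSq (conj a + Complex.I * conj b) =
      4 * (a.im * b.re - a.re * b.im) := by
    simp only [Complex.normSq_apply, Complex.add_re, Complex.add_im, Complex.mul_re, Complex.mul_im,
      Complex.I_re, Complex.I_im, Complex.conj_re, Complex.conj_im]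
    ring
  have hW : (b * conj a).im = -(a.im * b.re - a.re * b.im) := by
    simp only [Complex.mul_im, Complex.conj_re, Complex.conj_im]
    ring
  rw [hW]
  linarith

/-- **Lemma 1.8 (4), as printed**: if `f ≪ g` then `Im (g(z)/f(z)) ≥ 0` on `ℋⁿ` (for `h = g + if`; where
`f(z) = 0` the quotient is `0`). [cite: BorceaBranden2009, §1 Lemma 1.8 ((1) ⇒ (4))] -/
theorem IsProperPosition.im_div_nonneg (h : IsProperPosition f g) {z : σ → ℂ} (hz : ∀ i, 0 < (z i).im) :
    0 ≤ (eval z (map (algebraMap ℝ ℂ) g) / eval z (map (algebraMap ℝ ℂ) f)).im := by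
  rw [im_div_eq, im_mul_conj_swap]
  exact div_nonneg (neg_nonneg.2 (h.im_eval_mul_conj_nonpos hz)) (Complex.normSq_nonneg _)

/-- Equivalently `Im (f(z)/g(z)) ≤ 0` on `ℋⁿ` when `f ≪ g`. [cite: BorceaBranden2009, §1 Lemma 1.8 ((1) ⇒ (4))] -/
theorem IsProperPosition.im_div_nonpos (h : IsProperPosition f g) {z : σ → ℂ} (hz : ∀ i, 0 < (z i).im) :
    (eval z (map (algebraMap ℝ ℂ) f) / eval z (map (algebraMap ℝ ℂ) g)).im ≤ 0 := by
  rw [im_div_eq]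
  exact div_nonpos_of_nonpos_of_nonneg (h.im_eval_mul_conj_nonpos hz) (Complex.normSq_nonneg _)

/-- **Lemma 1.8, (4) ⇒ (1) (Hermite–Biehler sufficiency, half-plane form)**, degenerate cases included: if each
of `f, g` is real stable or zero, not both are zero, and `Im (f(z) · conj g(z)) ≤ 0` on `ℋⁿ`, then `f ≪ g`.
(At a zero `z ∈ ℋⁿ` of `g + if` one has `g(z) = −i f(z)`, so `Im (f(z) conj g(z)) = |f(z)|²`, forcing
`f(z) = g(z) = 0`.) [cite: BorceaBranden2009, §1 Lemma 1.8 ((4) ⇒ (3) ⇒ (1)) and its proof] -/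
theorem IsProperPosition.of_im_eval_mul_conj_nonpos (hf : f = 0 ∨ IsRealStable f) (hg : g = 0 ∨ IsRealStable g)
    (hne : ¬(f = 0 ∧ g = 0))
    (hW : ∀ z : σ → ℂ, (∀ i, 0 < (z i).im) →
      (eval z (map (algebraMap ℝ ℂ) f) * conj (eval z (map (algebraMap ℝ ℂ) g))).im ≤ 0) :
    IsProperPosition f g := by
  rw [isProperPosition_iff_forall]
  intro z hz H0
  set a := eval z (map (algebraMap ℝ ℂ) g) with ha
  set b := eval z (map (algebraMap ℝ ℂ) f) with hb
  have hab : a = -(Complex.I * b) := eq_neg_of_add_eq_zero_left H0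
  have hWz := hW z hz
  rw [← ha, ← hb, hab, map_neg, map_mul, Complex.conj_I] at hWz
  have hb2 : (b * -(-Complex.I * conj b)).im = Complex.normSq b := by
    simp only [neg_mul, neg_neg, Complex.mul_im, Complex.mul_re, Complex.I_re, Complex.I_im, Complex.conj_re,
      Complex.conj_im, Complex.normSq_apply]
    ring
  rw [hb2] at hWz
  have hb0 : b = 0 := Complex.normSq_eq_zero.1 (le_antisymm hWz (Complex.normSq_nonneg _))
  have ha0 : a = 0 := by rw [hab, hb0, mul_zero, neg_zero]
  rcases hf with rfl | hfs
  · rcases hg with rfl | hgs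
    · exact hne ⟨rfl, rfl⟩
    · exact hgs z hz ha0
  · exact hfs z hz hb0

variable [Fintype σ]

/-- **The open-mapping step.** Let `u, v ∈ ℝ[z₁,…,zₙ]`, `w ∈ ℂⁿ` with `v(w) ≠ 0`, and suppose
`Im (u(z) · conj v(z)) ≤ 0` for `z` near `w` while `Im (u(w) · conj v(w)) = 0`. Then `u = c · v` with the real
constant `c = u(w)/v(w)`: the analytic function `u/v` takes the real value `c` at `w` and maps a neighbourhood of
`w` into `{Im ≤ 0}`, which is not a neighbourhood of `c`; by the open mapping theorem `u/v` is constant near `w`,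
hence `u − c v = 0` by the identity principle. (This replaces the real specialisation `z_{n+1} = a` — Lemma 1.7 (1)
— in the printed proofs of Lemma 1.8 and Theorem 1.9: "`f(z) + a g(z)` is either a stable polynomial or
identically zero. Since it vanishes for `z = α + iβ` it must be identically zero".)
[cite: BorceaBranden2009, §1 proofs of Lemma 1.8 ((3) ⇒ (2)) and of Theorem 1.9] -/
theorem eq_C_mul_of_im_eval_mul_conj_nonpos {u v : MvPolynomial σ ℝ} {w : σ → ℂ}
    (hv : eval w (map (algebraMap ℝ ℂ) v) ≠ 0)
    (hle : ∀ᶠ z in 𝓝 w,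
      (eval z (map (algebraMap ℝ ℂ) u) * conj (eval z (map (algebraMap ℝ ℂ) v))).im ≤ 0)
    (h0 : (eval w (map (algebraMap ℝ ℂ) u) * conj (eval w (map (algebraMap ℝ ℂ) v))).im = 0) :
    u = C ((eval w (map (algebraMap ℝ ℂ) u) / eval w (map (algebraMap ℝ ℂ) v)).re) * v := by
  set U := map (algebraMap ℝ ℂ) u with hU
  set V := map (algebraMap ℝ ℂ) v with hV
  have hcim : (eval w U / eval w V).im = 0 := by rw [im_div_eq, h0, zero_div]
  have hcre : ((((eval w U / eval w V).re : ℝ) : ℂ)) = eval w U / eval w V :=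
    Complex.ext (by simp) (by simp [hcim])
  have hUan : AnalyticOnNhd ℂ (fun z => eval z U) univ := AnalyticOnNhd.eval_mvPolynomial U
  have hVan : AnalyticOnNhd ℂ (fun z => eval z V) univ := AnalyticOnNhd.eval_mvPolynomial V
  have hRan : AnalyticAt ℂ (fun z => eval z U / eval z V) w :=
    (hUan w (mem_univ _)).div (hVan w (mem_univ _)) hv
  rcases hRan.eventually_constant_or_nhds_le_map_nhds with hA | hB
  · -- `U/V` is constant near `w`, hence `U - c V = 0`
    have hVne : ∀ᶠ z in 𝓝 w, eval z V ≠ 0 :=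
      (MvPolynomial.continuous_eval (p := V)).continuousAt.eventually_ne hv
    have hUV : (fun z => eval z (U - C (eval w U / eval w V) * V)) =ᶠ[𝓝 w] fun _ => (0 : ℂ) := by
      filter_upwards [hA, hVne] with z hz hzV
      have hz' : eval z U = eval w U / eval w V * eval z V := by
        rw [← div_eq_iff hzV]
        exact hz
      simp [hz']
    have hzero : (fun z => eval z (U - C (eval w U / eval w V) * V)) = fun _ => (0 : ℂ) :=
      AnalyticOnNhd.eq_of_eventuallyEq (AnalyticOnNhd.eval_mvPolynomial _) analyticOnNhd_const hUV
    have hUV' : U - C (eval w U / eval w V) * V = 0 :=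
      MvPolynomial.funext fun z => by
        rw [map_zero]
        exact congrFun hzero z
    have hmap : MvPolynomial.map (algebraMap ℝ ℂ) (u - C ((eval w U / eval w V).re) * v) =
        MvPolynomial.map (algebraMap ℝ ℂ) 0 := by
      rw [map_sub, map_mul, map_C, map_zero, ← hU, ← hV, ← hUV']
      congr 2
      exact congrArg C hcre
    exact sub_eq_zero.1 (MvPolynomial.map_injective (algebraMap ℝ ℂ) (RingHom.injective _) hmap)
  · -- open mapping: `{Im ≤ 0}` would be a neighbourhood of the real number `U(w)/V(w)`
    exfalso
    have hmem : {ζ : ℂ | ζ.im ≤ 0} ∈ map (fun z => eval z U / eval z V) (𝓝 w) := by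
      rw [mem_map]
      filter_upwards [hle] with z hz
      show (eval z U / eval z V).im ≤ 0
      rw [im_div_eq]
      exact div_nonpos_of_nonpos_of_nonneg hz (Complex.normSq_nonneg _)
    have hint := mem_interior_iff_mem_nhds.2 (hB hmem)
    rw [Complex.interior_setOf_im_le] at hint
    exact (lt_irrefl (0 : ℝ)) (hcim ▸ hint)

/-- The open-mapping step with the opposite sign: `Im (u · conj v) ≥ 0` near `w`, `= 0` at `w`, `v(w) ≠ 0`
`⇒ u = c v`. [cite: BorceaBranden2009, §1 proof of Theorem 1.9] -/
theorem eq_C_mul_of_im_eval_mul_conj_nonneg {u v : MvPolynomial σ ℝ} {w : σ → ℂ}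
    (hv : eval w (map (algebraMap ℝ ℂ) v) ≠ 0)
    (hle : ∀ᶠ z in 𝓝 w,
      0 ≤ (eval z (map (algebraMap ℝ ℂ) u) * conj (eval z (map (algebraMap ℝ ℂ) v))).im)
    (h0 : (eval w (map (algebraMap ℝ ℂ) u) * conj (eval w (map (algebraMap ℝ ℂ) v))).im = 0) :
    u = C ((eval w (map (algebraMap ℝ ℂ) u) / eval w (map (algebraMap ℝ ℂ) v)).re) * v := by
  have hle' : ∀ᶠ z in 𝓝 w,
      (eval z (map (algebraMap ℝ ℂ) (-u)) * conj (eval z (map (algebraMap ℝ ℂ) v))).im ≤ 0 := by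
    filter_upwards [hle] with z hz
    rw [map_neg, map_neg, neg_mul, Complex.neg_im]
    exact neg_nonpos.2 hz
  have h0' : (eval w (map (algebraMap ℝ ℂ) (-u)) * conj (eval w (map (algebraMap ℝ ℂ) v))).im = 0 := by
    rw [map_neg, map_neg, neg_mul, Complex.neg_im, h0, neg_zero]
  have key := eq_C_mul_of_im_eval_mul_conj_nonpos hv hle' h0'
  rw [map_neg, map_neg, neg_div, Complex.neg_re, C_neg, neg_mul, neg_inj] at key
  exact key

/-- The open upper half-space `ℋⁿ` is a neighbourhood of each of its points.
[cite: BorceaBranden2009, §1 (the domain `{ζ : Im ζ > 0}ⁿ`)] -/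
private theorem upperHalfSpace_mem_nhds {w : σ → ℂ} (hw : ∀ i, 0 < (w i).im) :
    {z : σ → ℂ | ∀ i, 0 < (z i).im} ∈ 𝓝 w :=
  isOpen_upperHalfSpace.mem_nhds hw

/-- **Lemma 1.8, (1) ⇒ "`f ∈ 𝓗ₙ(ℝ)`"** (with the degenerate case): if `f ≪ g` then `f = 0` or `f` is real stable.
(At a zero `w ∈ ℋⁿ` of `f`, `g(w) ≠ 0` and `f/g` takes the real value `0`; the open-mapping step gives `f = 0·g`.)
[cite: BorceaBranden2009, §1 Lemma 1.8 ((1) ⇒ (4))] -/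
theorem IsProperPosition.eq_zero_or_isRealStable_left (h : IsProperPosition f g) : f = 0 ∨ IsRealStable f := by
  classical
  by_cases hf0 : f = 0
  · exact Or.inl hf0
  refine Or.inr fun w hw hFw => hf0 ?_
  have hGw : eval w (map (algebraMap ℝ ℂ) g) ≠ 0 := by
    intro hGw
    exact (isProperPosition_iff_forall f g).1 h w hw (by rw [hFw, hGw, mul_zero, add_zero])
  have key := eq_C_mul_of_im_eval_mul_conj_nonpos (u := f) (v := g) hGw
    (by
      filter_upwards [upperHalfSpace_mem_nhds hw] with z hz
      exact h.im_eval_mul_conj_nonpos hz)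
    (by rw [hFw, zero_mul, Complex.zero_im])
  rw [hFw, zero_div, Complex.zero_re, C_0, zero_mul] at key
  exact key

/-- **Lemma 1.8, (1) ⇒ "`g ∈ 𝓗ₙ(ℝ)`"** (with the degenerate case): if `f ≪ g` then `g = 0` or `g` is real stable.
[cite: BorceaBranden2009, §1 Lemma 1.8 ((1) ⇒ (4))] -/
theorem IsProperPosition.eq_zero_or_isRealStable_right (h : IsProperPosition f g) : g = 0 ∨ IsRealStable g := by
  classical
  by_cases hg0 : g = 0
  · exact Or.inl hg0
  refine Or.inr fun w hw hGw => hg0 ?_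
  have hFw : eval w (map (algebraMap ℝ ℂ) f) ≠ 0 := by
    intro hFw
    exact (isProperPosition_iff_forall f g).1 h w hw (by rw [hFw, hGw, mul_zero, add_zero])
  have key := eq_C_mul_of_im_eval_mul_conj_nonneg (u := g) (v := f) hFw
    (by
      filter_upwards [upperHalfSpace_mem_nhds hw] with z hz
      rw [im_mul_conj_swap]
      exact neg_nonneg.2 (h.im_eval_mul_conj_nonpos hz))
    (by rw [hGw, zero_mul, Complex.zero_im])
  rw [hGw, zero_div, Complex.zero_re, C_0, zero_mul] at key
  exact key

/-- **Lemma 1.8, (1) ⇔ (4), with the degenerate cases (the half-plane form of the Hermite–Biehler theorem)**: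
`f ≪ g` iff each of `f, g` is real stable or zero, not both are zero, and `Im (f(z) · conj g(z)) ≤ 0` for all
`z ∈ ℋⁿ` (equivalently, `Im (g(z)/f(z)) ≥ 0` wherever `f(z) ≠ 0`).
[cite: BorceaBranden2009, §1 Lemma 1.8 ((1) ⇔ (4))] -/
theorem isProperPosition_iff (f g : MvPolynomial σ ℝ) :
    IsProperPosition f g ↔ (f = 0 ∨ IsRealStable f) ∧ (g = 0 ∨ IsRealStable g) ∧ ¬(f = 0 ∧ g = 0) ∧
      ∀ z : σ → ℂ, (∀ i, 0 < (z i).im) →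
        (eval z (map (algebraMap ℝ ℂ) f) * conj (eval z (map (algebraMap ℝ ℂ) g))).im ≤ 0 :=
  ⟨fun h => ⟨h.eq_zero_or_isRealStable_left, h.eq_zero_or_isRealStable_right, h.not_and_eq_zero,
    fun _ hz => h.im_eval_mul_conj_nonpos hz⟩,
    fun h => IsProperPosition.of_im_eval_mul_conj_nonpos h.1 h.2.1 h.2.2.1 h.2.2.2⟩

end HalfPlane

/-! ## §4 Lemma 1.8, (1) ⇔ (3): `f ≪ g ↔ g + z_{n+1} f ∈ 𝓗_{n+1}(ℝ)` -/

section NewVariable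

variable {f g : MvPolynomial σ ℝ}

/-- `(g + z_{new} f)(z) = g(z|_σ) + z_{new} f(z|_σ)` for the polynomial in the variables `Option σ`.
[cite: BorceaBranden2009, §1 Lemma 1.8 (3) ("`q(z_{n+1}) = f(w) + z_{n+1} g(w)`")] -/
theorem eval_map_rename_add_X_mul (f g : MvPolynomial σ ℝ) (z : Option σ → ℂ) :
    eval z (map (algebraMap ℝ ℂ) (rename some g + X none * rename some f)) =
      eval (fun i => z (some i)) (map (algebraMap ℝ ℂ) g) +
        z none * eval (fun i => z (some i)) (map (algebraMap ℝ ℂ) f) := by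
  simp only [map_add, map_mul, map_X, map_rename, eval_X, eval_rename, Function.comp_def]

/-- **Lemma 1.8, (1) ⇔ (3)**: `f ≪ g` iff `g + z_{n+1} f` is real stable (as a polynomial in the variables
`Option σ`, the new variable being `none`). ((1) ⇒ (3): where `f(w) = 0`, `g(w) ≠ 0`; elsewhere
`Im (g(w)/f(w)) ≥ 0` and `Im z_{n+1} > 0`. (3) ⇒ (1): put `z_{n+1} = i`.)
[cite: BorceaBranden2009, §1 Lemma 1.8 ((1) ⇔ (3)) and its proof] -/
theorem isProperPosition_iff_isRealStable_add_X_mul (f g : MvPolynomial σ ℝ) :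
    IsProperPosition f g ↔
      IsRealStable (rename some g + X none * rename some f : MvPolynomial (Option σ) ℝ) := by
  constructor
  · intro h z hz H0
    rw [eval_map_rename_add_X_mul] at H0
    set w : σ → ℂ := fun i => z (some i) with hw'
    have hw : ∀ i, 0 < (w i).im := fun i => hz (some i)
    by_cases hFw : eval w (map (algebraMap ℝ ℂ) f) = 0
    · rw [hFw, mul_zero, add_zero] at H0
      exact (isProperPosition_iff_forall f g).1 h w hw (by rw [H0, hFw, mul_zero, add_zero])
    · have h1 : eval w (map (algebraMap ℝ ℂ) g) / eval w (map (algebraMap ℝ ℂ) f) = -z none := by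
        rw [div_eq_iff hFw]
        linear_combination H0
      have h2 := h.im_div_nonneg hw
      rw [h1, Complex.neg_im] at h2
      linarith [hz none]
  · intro h
    rw [isProperPosition_iff_forall]
    intro w hw H0
    have hz : ∀ i, 0 < ((fun o : Option σ => Option.elim o Complex.I w) i).im := by
      rintro (_ | i)
      · simp
      · exact hw i
    refine h _ hz ?_
    rw [eval_map_rename_add_X_mul]
    simpa [mul_comm] using H0

end NewVariable

/-! ## §5 Theorem 1.9 (Hermite–Kakeya–Obreschkoff, several variables) and Corollary 1.10 -/

section Pencil

variable [Fintype σ] {f g : MvPolynomial σ ℝ}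

/-- **Theorem 1.9, "if" half**: if `f ≪ g` then every polynomial `a f + b g` (`a, b ∈ ℝ`) of the pencil is real
stable or zero. (A zero `w ∈ ℋⁿ` of `af + bg` with `b ≠ 0` makes `g/f` real at `w`, so `g = −(a/b) f` by the
open-mapping step; `b = 0` forces `f(w) = 0`, hence `f = 0`.) [cite: BorceaBranden2009, §1 Theorem 1.9 ("if")
and its proof] -/
theorem IsProperPosition.pencil (h : IsProperPosition f g) (a b : ℝ) :
    C a * f + C b * g = 0 ∨ IsRealStable (C a * f + C b * g) := by
  classical
  by_cases hzero : C a * f + C b * g = 0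
  · exact Or.inl hzero
  refine Or.inr fun w hw H0 => hzero ?_
  simp only [map_add, map_mul, map_C, eval_C, Complex.coe_algebraMap] at H0
  by_cases hb : b = 0
  · subst hb
    have ha : a ≠ 0 := by
      rintro rfl
      exact hzero (by simp)
    have hFw : eval w (map (algebraMap ℝ ℂ) f) = 0 := by
      simpa [ha] using H0
    rcases h.eq_zero_or_isRealStable_left with hf0 | hfs
    · rw [hf0]
      simp
    · exact absurd hFw (hfs w hw)
  · have hFw : eval w (map (algebraMap ℝ ℂ) f) ≠ 0 := by
      intro hFw
      have hGw : eval w (map (algebraMap ℝ ℂ) g) = 0 := by simpa [hFw, hb] using H0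
      exact (isProperPosition_iff_forall f g).1 h w hw (by rw [hFw, hGw, mul_zero, add_zero])
    have hbC : (b : ℂ) ≠ 0 := by exact_mod_cast hb
    have hG : eval w (map (algebraMap ℝ ℂ) g) = ((-a / b : ℝ) : ℂ) * eval w (map (algebraMap ℝ ℂ) f) := by
      push_cast
      field_simp
      linear_combination H0
    have hq : eval w (map (algebraMap ℝ ℂ) g) / eval w (map (algebraMap ℝ ℂ) f) = ((-a / b : ℝ) : ℂ) := by
      rw [hG, mul_div_assoc, div_self hFw, mul_one]
    have key := eq_C_mul_of_im_eval_mul_conj_nonneg (u := g) (v := f) hFw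
      (by
        filter_upwards [isOpen_upperHalfSpace.mem_nhds hw] with z hz
        rw [im_mul_conj_swap]
        exact neg_nonneg.2 (h.im_eval_mul_conj_nonpos hz))
      (by rw [hG, mul_assoc, Complex.mul_conj, ← Complex.ofReal_mul, Complex.ofReal_im])
    rw [hq, Complex.ofReal_re] at key
    rw [key, ← mul_assoc, ← C_mul, ← add_mul, ← C_add]
    have : a + b * (-a / b) = 0 := by
      field_simp
      ring
    rw [this, C_0, zero_mul]

omit [Fintype σ] in
/-- `ℋⁿ` is preconnected (it is convex). [cite: BorceaBranden2009, §1 proof of Theorem 1.9 ("By connectivity")] -/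
private theorem isPreconnected_upperHalfSpace : IsPreconnected {z : σ → ℂ | ∀ i, 0 < (z i).im} := by
  have hset : {z : σ → ℂ | ∀ i, 0 < (z i).im} = ⋂ i, {z : σ → ℂ | 0 < (z i).im} := by
    ext z
    simp
  rw [hset]
  refine (convex_iInter fun i => ?_).isPreconnected
  exact convex_halfSpace_gt (f := fun z : σ → ℂ => (z i).im) ⟨fun x y => by simp, fun c x => by simp⟩ 0

omit [Fintype σ] in
/-- `z ↦ Im (f(z) · conj g(z))` is continuous. [cite: BorceaBranden2009, §1 proof of Theorem 1.9] -/
private theorem continuous_im_eval_mul_conj (f g : MvPolynomial σ ℝ) :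
    Continuous fun z : σ → ℂ =>
      (eval z (map (algebraMap ℝ ℂ) f) * conj (eval z (map (algebraMap ℝ ℂ) g))).im :=
  Complex.continuous_im.comp ((MvPolynomial.continuous_eval (p := _)).mul
    (Complex.continuous_conj.comp (MvPolynomial.continuous_eval (p := _))))

/-- **Theorem 1.9 (Hermite–Kakeya–Obreschkoff, several variables).** For `f, g ∈ ℝ[z₁,…,zₙ]`: all nonzero
polynomials `a f + b g` (`a, b ∈ ℝ`) are real stable iff `f = g = 0`, `f ≪ g` or `g ≪ f`. ("Only if", as printed:
`f, g` are real stable or zero; if `Im (f·conj g)` took both signs on `ℋⁿ`, by connectivity it would vanish at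
some `v ∈ ℋⁿ`, where either `g(v) = 0` — so `g = 0` — or `f(v)/g(v) = a ∈ ℝ` — so `f − ag`, vanishing at `v`,
is `0`; either way `Im (f·conj g) ≡ 0`, a contradiction; a constant sign gives `f ≪ g` or `g ≪ f` by Lemma 1.8
(4) ⇒ (1).) [cite: BorceaBranden2009, §1 Theorem 1.9 and its proof] -/
theorem isRealStable_pencil_iff (f g : MvPolynomial σ ℝ) :
    (∀ a b : ℝ, C a * f + C b * g = 0 ∨ IsRealStable (C a * f + C b * g)) ↔
      (f = 0 ∧ g = 0) ∨ IsProperPosition f g ∨ IsProperPosition g f := by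
  classical
  constructor
  · intro h
    by_cases hfg : f = 0 ∧ g = 0
    · exact Or.inl hfg
    right
    have hf : f = 0 ∨ IsRealStable f := by simpa using h 1 0
    have hg : g = 0 ∨ IsRealStable g := by simpa using h 0 1
    by_cases hle : ∀ z : σ → ℂ, (∀ i, 0 < (z i).im) →
        (eval z (map (algebraMap ℝ ℂ) f) * conj (eval z (map (algebraMap ℝ ℂ) g))).im ≤ 0
    · exact Or.inl (IsProperPosition.of_im_eval_mul_conj_nonpos hf hg hfg hle)
    by_cases hge : ∀ z : σ → ℂ, (∀ i, 0 < (z i).im) →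
        (eval z (map (algebraMap ℝ ℂ) g) * conj (eval z (map (algebraMap ℝ ℂ) f))).im ≤ 0
    · exact Or.inr (IsProperPosition.of_im_eval_mul_conj_nonpos hg hf (fun h' => hfg ⟨h'.2, h'.1⟩) hge)
    exfalso
    push Not at hle hge
    obtain ⟨z₀, hz₀, h₀⟩ := hle
    obtain ⟨z₁, hz₁, h₁⟩ := hge
    rw [im_mul_conj_swap] at h₁
    -- by connectivity `Im (f conj g)` vanishes somewhere on `ℋⁿ`
    obtain ⟨v, hv, hWv⟩ := isPreconnected_upperHalfSpace.intermediate_value hz₁ hz₀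
      (continuous_im_eval_mul_conj f g).continuousOn ⟨by linarith, h₀.le⟩
    dsimp only at hWv
    by_cases hGv : eval v (map (algebraMap ℝ ℂ) g) = 0
    · rcases hg with hg0 | hgs
      · have hW0 : (eval z₀ (map (algebraMap ℝ ℂ) f) * conj (eval z₀ (map (algebraMap ℝ ℂ) g))).im = 0 := by
          simp [hg0]
        linarith
      · exact hgs v hv hGv
    · set a : ℝ := (eval v (map (algebraMap ℝ ℂ) f) / eval v (map (algebraMap ℝ ℂ) g)).re with ha
      have hquot : eval v (map (algebraMap ℝ ℂ) f) / eval v (map (algebraMap ℝ ℂ) g) = (a : ℂ) :=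
        Complex.ext (by simp [ha]) (by rw [im_div_eq, hWv, zero_div, Complex.ofReal_im])
      have hFv : eval v (map (algebraMap ℝ ℂ) f) = (a : ℂ) * eval v (map (algebraMap ℝ ℂ) g) := by
        rw [← hquot, div_mul_cancel₀ _ hGv]
      have hcombo : C 1 * f + C (-a) * g = 0 := by
        rcases h 1 (-a) with h0 | hst
        · exact h0
        · exfalso
          refine hst v hv ?_
          simp only [map_add, map_mul, map_C, eval_C, Complex.coe_algebraMap, hFv]
          push_cast
          ring
      have hfag : f = C a * g := by
        rwa [C_1, one_mul, C_neg, neg_mul, ← sub_eq_add_neg, sub_eq_zero] at hcombo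
      have hW0 : (eval z₀ (map (algebraMap ℝ ℂ) f) * conj (eval z₀ (map (algebraMap ℝ ℂ) g))).im = 0 := by
        rw [hfag, map_mul, map_C, map_mul, eval_C, Complex.coe_algebraMap, mul_assoc, Complex.mul_conj,
          ← Complex.ofReal_mul, Complex.ofReal_im]
      linarith
  · rintro (⟨rfl, rfl⟩ | h | h) a b
    · left
      simp
    · exact h.pencil a b
    · rcases h.pencil b a with h0 | hst
      · left
        rwa [add_comm]
      · right
        rwa [add_comm]

/-- **Corollary 1.10**: if `f ≪ g` and `g ≪ f` with `g ≠ 0` then `f = a g` for a real constant `a`.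
(`Im (f·conj g)` is both `≤ 0` and `≥ 0` on `ℋⁿ`; apply the open-mapping step at any point of `ℋⁿ`, where
`g ≠ 0` by real stability.) [cite: BorceaBranden2009, §1 Corollary 1.10] -/
theorem IsProperPosition.exists_eq_C_mul (hfg : IsProperPosition f g) (hgf : IsProperPosition g f) (hg : g ≠ 0) :
    ∃ a : ℝ, f = C a * g := by
  have hgs : IsRealStable g := hfg.eq_zero_or_isRealStable_right.resolve_left hg
  have hw : ∀ i : σ, 0 < ((fun _ => Complex.I : σ → ℂ) i).im := fun _ => by simp
  have hGw := hgs _ hw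
  have hge := hgf.im_eval_mul_conj_nonpos hw
  rw [im_mul_conj_swap] at hge
  exact ⟨_, eq_C_mul_of_im_eval_mul_conj_nonpos (u := f) (v := g) hGw
    (by
      filter_upwards [isOpen_upperHalfSpace.mem_nhds hw] with z hz
      exact hfg.im_eval_mul_conj_nonpos hz)
    (le_antisymm (hfg.im_eval_mul_conj_nonpos hw) (by linarith))⟩

end Pencil

/-! ## §6 Theorem 1.9, "moreover": the Wronskians `Wⱼ[g,f] = ∂ⱼg·f − g·∂ⱼf` -/

section Wronskian

variable [Fintype σ] {f g : MvPolynomial σ ℝ}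

/-- Along `y ↦ R(iy)` a complex polynomial `R` has real-variable derivative `R'(iy)·i`.
[cite: BorceaBranden2009, §1 proof of Theorem 1.9 (first-order Taylor expansion of `f/g` along a line)] -/
private theorem hasDerivAt_eval_I_mul (R : ℂ[X]) (y : ℝ) :
    HasDerivAt (fun s : ℝ => R.eval (Complex.I * s)) (R.derivative.eval (Complex.I * y) * Complex.I) y := by
  have hlin : HasDerivAt (fun t : ℂ => Complex.I * t) Complex.I (y : ℂ) := by
    simpa using (hasDerivAt_id' (y : ℂ)).const_mul Complex.I
  have h1 : HasDerivAt (fun t : ℂ => R.eval (Complex.I * t)) (R.derivative.eval (Complex.I * y) * Complex.I)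
      (y : ℂ) :=
    (R.hasDerivAt (Complex.I * (y : ℂ))).comp (y : ℂ) hlin
  exact h1.comp_ofReal

/-- **Theorem 1.9, "moreover", directional form**: if `f ≪ g` then `∑ⱼ vⱼ Wⱼ[g,f](x) ≥ 0` for every real point
`x` and every direction `v` with all `vⱼ > 0`. (Differentiate `y ↦ Im (f·conj g)(x + iyv)` — nonpositive for
`y > 0`, zero at `y = 0` — at `y = 0`: the derivative is `∑ⱼ vⱼ (∂ⱼf·g − f·∂ⱼg)(x)`.)
[cite: BorceaBranden2009, §1 Theorem 1.9 ("Moreover") and its proof] -/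
theorem IsProperPosition.sum_mul_wronskian_nonneg (h : IsProperPosition f g) (x : σ → ℝ) {v : σ → ℝ}
    (hv : ∀ j, 0 < v j) :
    0 ≤ ∑ j, v j * eval x (pderiv j g * f - g * pderiv j f) := by
  classical
  set F := map (algebraMap ℝ ℂ) f with hF
  set G := map (algebraMap ℝ ℂ) g with hG
  set xc : σ → ℂ := fun j => ((x j : ℝ) : ℂ) with hxc
  set vc : σ → ℂ := fun j => ((v j : ℝ) : ℂ) with hvc
  set P := linePoly F xc vc with hP
  set Q := linePoly G xc vc with hQ
  have hPt : ∀ t : ℂ, P.eval t = eval (fun j => xc j + t * vc j) F := fun t => eval_linePoly F xc vc t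
  have hQt : ∀ t : ℂ, Q.eval t = eval (fun j => xc j + t * vc j) G := fun t => eval_linePoly G xc vc t
  -- the point `y = 0` of the path `y ↦ x + iyv` is the real point `x`
  have hpt0 : (fun j => xc j + Complex.I * ((0 : ℝ) : ℂ) * vc j) = fun j => ((x j : ℝ) : ℂ) := by
    funext j
    simp [hxc]
  have hP0 : P.eval (Complex.I * ((0 : ℝ) : ℂ)) = ((eval x f : ℝ) : ℂ) := by
    rw [hPt, hpt0, hF, eval_map_algebraMap_ofReal]
  have hQ0 : Q.eval (Complex.I * ((0 : ℝ) : ℂ)) = ((eval x g : ℝ) : ℂ) := by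
    rw [hQt, hpt0, hG, eval_map_algebraMap_ofReal]
  have hderiv0 : ∀ q : MvPolynomial σ ℝ,
      (Polynomial.derivative (linePoly (map (algebraMap ℝ ℂ) q) xc vc)).eval (Complex.I * ((0 : ℝ) : ℂ)) =
        ((∑ j, v j * eval x (pderiv j q) : ℝ) : ℂ) := by
    intro q
    rw [derivative_linePoly, Polynomial.eval_finsetSum]
    push_cast
    refine Finset.sum_congr rfl fun j _ => ?_
    rw [Polynomial.eval_mul, Polynomial.eval_C, eval_linePoly, pderiv_map]
    simp only [hxc, hvc, mul_zero, zero_mul, add_zero, eval_map_algebraMap_ofReal]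
  have hP'0 := hderiv0 f
  have hQ'0 := hderiv0 g
  rw [← hF] at hP'0
  rw [← hG] at hQ'0
  -- `k(y) = P(iy) · conj Q(iy)` and its derivative at `0`
  have hk : HasDerivAt (fun y : ℝ => P.eval (Complex.I * y) * conj (Q.eval (Complex.I * y)))
      (P.derivative.eval (Complex.I * ((0 : ℝ) : ℂ)) * Complex.I * conj (Q.eval (Complex.I * ((0 : ℝ) : ℂ))) +
        P.eval (Complex.I * ((0 : ℝ) : ℂ)) *
          conj (Q.derivative.eval (Complex.I * ((0 : ℝ) : ℂ)) * Complex.I)) 0 :=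
    (hasDerivAt_eval_I_mul P 0).mul (hasDerivAt_eval_I_mul Q 0).star
  -- `Im k(y) ≤ 0` for `y > 0`, `Im k(0) = 0`
  have hk_nonpos : ∀ y : ℝ, 0 < y →
      (P.eval (Complex.I * y) * conj (Q.eval (Complex.I * y))).im ≤ 0 := by
    intro y hy
    rw [hPt, hQt]
    exact h.im_eval_mul_conj_nonpos fun j => by
      simp only [hxc, hvc, Complex.add_im, Complex.ofReal_im, Complex.mul_im, Complex.I_re, Complex.I_im,
        Complex.ofReal_re, Complex.mul_re, zero_mul, one_mul, zero_add, sub_zero, mul_zero]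
      exact mul_pos hy (hv j)
  have hk0 : (P.eval (Complex.I * ((0 : ℝ) : ℂ)) * conj (Q.eval (Complex.I * ((0 : ℝ) : ℂ)))).im = 0 := by
    rw [hP0, hQ0, Complex.conj_ofReal, ← Complex.ofReal_mul, Complex.ofReal_im]
  -- the imaginary parts of the right slopes are `≤ 0`, hence so is the imaginary part of the derivative
  have him := (Complex.continuous_im.tendsto _).comp hk.tendsto_slope_zero_right
  have hev : ∀ᶠ y in 𝓝[>] (0 : ℝ),
      (Complex.im ∘ fun y => y⁻¹ • ((fun y : ℝ => P.eval (Complex.I * y) * conj (Q.eval (Complex.I * y)))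
        (0 + y) - (fun y : ℝ => P.eval (Complex.I * y) * conj (Q.eval (Complex.I * y))) 0)) y ≤ 0 := by
    filter_upwards [self_mem_nhdsWithin] with y hy
    have hy' : (0 : ℝ) < y := hy
    simp only [Function.comp_apply, zero_add, Complex.smul_im, Complex.sub_im, smul_eq_mul]
    rw [hk0, sub_zero]
    exact mul_nonpos_of_nonneg_of_nonpos (inv_nonneg.2 hy'.le) (hk_nonpos y hy')
  have hle := le_of_tendsto him hev
  rw [hP0, hQ0, hP'0, hQ'0] at hle
  simp only [Complex.conj_ofReal, map_mul, Complex.conj_I, Complex.add_im, Complex.mul_im, Complex.mul_re,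
    Complex.ofReal_re, Complex.ofReal_im, Complex.I_re, Complex.I_im, Complex.neg_im,
    mul_zero, mul_one, sub_zero, add_zero, zero_add, mul_neg] at hle
  -- `hle : (∑ vⱼ ∂ⱼf(x)) g(x) − f(x) (∑ vⱼ ∂ⱼg(x)) ≤ 0`
  have hsum : ∑ j, v j * eval x (pderiv j g * f - g * pderiv j f) =
      eval x f * ∑ j, v j * eval x (pderiv j g) - eval x g * ∑ j, v j * eval x (pderiv j f) := by
    simp only [map_sub, map_mul, Finset.mul_sum, ← Finset.sum_sub_distrib]
    exact Finset.sum_congr rfl fun j _ => by ring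
  rw [hsum]
  linarith

/-- **Theorem 1.9, "moreover"**: if `f ≪ g` then `Wⱼ[g,f](x) = (∂ⱼg·f − g·∂ⱼf)(x) ≥ 0` for all `x ∈ ℝⁿ` and all
`j` (let the direction `v = eⱼ + δ·𝟙` of the directional form tend to `eⱼ`).
[cite: BorceaBranden2009, §1 Theorem 1.9 ("if `f ≪ g` then `Wⱼ[g,f](x) ≥ 0`")] -/
theorem IsProperPosition.wronskian_nonneg (h : IsProperPosition f g) (x : σ → ℝ) (j : σ) :
    0 ≤ eval x (pderiv j g * f - g * pderiv j f) := by
  classical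
  set c : σ → ℝ := fun k => eval x (pderiv k g * f - g * pderiv k f) with hc
  have hδ : ∀ δ : ℝ, 0 < δ → 0 ≤ c j + δ * ∑ k, c k := by
    intro δ hδ
    have key := h.sum_mul_wronskian_nonneg x (v := fun k => (if k = j then (1 : ℝ) else 0) + δ) fun k => by
      split_ifs <;> linarith
    calc (0 : ℝ) ≤ ∑ k, ((if k = j then (1 : ℝ) else 0) + δ) * c k := key
      _ = c j + δ * ∑ k, c k := by
        simp only [add_mul, Finset.sum_add_distrib, ite_mul, one_mul, zero_mul, Finset.sum_ite_eq',
          Finset.mem_univ, if_true, Finset.mul_sum]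
  have htend : Tendsto (fun δ : ℝ => c j + δ * ∑ k, c k) (𝓝[>] 0) (𝓝 (c j)) := by
    have hcont : Continuous fun δ : ℝ => c j + δ * ∑ k, c k := by fun_prop
    have h2 := hcont.tendsto 0
    simp only [zero_mul, add_zero] at h2
    exact h2.mono_left nhdsWithin_le_nhds
  exact ge_of_tendsto htend (by
    filter_upwards [self_mem_nhdsWithin] with δ hδpos
    exact hδ δ hδpos)

/-- **Theorem 1.9, "moreover"**: if `g ≪ f` then `Wⱼ[g,f](x) = (∂ⱼg·f − g·∂ⱼf)(x) ≤ 0` for all `x ∈ ℝⁿ` and all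
`j`. [cite: BorceaBranden2009, §1 Theorem 1.9 ("if `g ≪ f` then `Wⱼ[g,f](x) ≤ 0`")] -/
theorem IsProperPosition.wronskian_nonpos (h : IsProperPosition g f) (x : σ → ℝ) (j : σ) :
    eval x (pderiv j g * f - g * pderiv j f) ≤ 0 := by
  have key := h.wronskian_nonneg x j
  have e : eval x (pderiv j g * f - g * pderiv j f) = -eval x (pderiv j f * g - f * pderiv j g) := by
    simp only [map_sub, map_mul]
    ring
  rw [e]
  exact neg_nonpos.2 key

end Wronskian

/-! ## §7 Lemma 1.8 (1) ⇔ (5) (line form), the strict inequality (2), and Brändén's Corollary 5.5 -/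

section LineStrictTFAE

variable {f g : MvPolynomial σ ℝ}

/-- **Lemma 1.8, (1) ⇔ (5)**, through Lemma 1.5 (`isUpperHalfPlaneStable_iff_line`): `f ≪ g` iff for every
`α ∈ ℝⁿ` and every `λ ∈ ℝⁿ` with all `λᵢ > 0` the univariate restriction `t ↦ g(α + tλ) + i f(α + tλ)` has no
zero in `H` — that is, `f(λt + α) ≪ g(λt + α)` as univariate polynomials.
[cite: BorceaBranden2009, §1 Lemma 1.8 ((1) ⇔ (5)) and Lemma 1.5] -/
theorem isProperPosition_iff_line (f g : MvPolynomial σ ℝ) :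
    IsProperPosition f g ↔ ∀ (a b : σ → ℝ), (∀ i, 0 < b i) → ∀ t : ℂ, 0 < t.im →
      eval (fun i => (a i : ℂ) + t * b i) (map (algebraMap ℝ ℂ) g) +
        Complex.I * eval (fun i => (a i : ℂ) + t * b i) (map (algebraMap ℝ ℂ) f) ≠ 0 := by
  rw [IsProperPosition, isUpperHalfPlaneStable_iff_line]
  simp only [map_add, map_mul, eval_C]

variable [Fintype σ]

/-- **Lemma 1.8, (1) ⇒ (2) (strict form, as printed)**: if `f ≪ g`, `g ≠ 0` and `f` is not a constant multiple
of `g`, then `|h(z̄)| < |h(z)|` on `ℋⁿ` for `h = g + if`. (Equality at `z` gives `Im (f(z)·conj g(z)) = 0`; then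
`g(z) = 0` contradicts the real stability of `g`, and `g(z) ≠ 0` makes `f` a constant multiple of `g` by the
open-mapping step — the printed proof reads the equality off the zeros of `h(α + tβ)` and specialises
`z_{n+1} = a` instead.) [cite: BorceaBranden2009, §1 Lemma 1.8 ((1) ⇒ (2)) and its proof] -/
theorem IsProperPosition.norm_eval_conj_lt (h : IsProperPosition f g) (hg : g ≠ 0)
    (hfg : ∀ c : ℝ, f ≠ C c * g) {z : σ → ℂ} (hz : ∀ i, 0 < (z i).im) :
    ‖eval (fun i => conj (z i)) (map (algebraMap ℝ ℂ) g + C Complex.I * map (algebraMap ℝ ℂ) f)‖ <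
      ‖eval z (map (algebraMap ℝ ℂ) g + C Complex.I * map (algebraMap ℝ ℂ) f)‖ := by
  refine lt_of_le_of_ne (IsUpperHalfPlaneStable.norm_eval_conj_le h hz) fun heq => ?_
  rw [map_add, map_mul, eval_C, map_add, map_mul, eval_C, ← conj_eval_map_eq_eval_conj,
    ← conj_eval_map_eq_eval_conj] at heq
  set a := eval z (map (algebraMap ℝ ℂ) g) with ha
  set b := eval z (map (algebraMap ℝ ℂ) f) with hb
  have hsq : Complex.normSq (conj a + Complex.I * conj b) = Complex.normSq (a + Complex.I * b) := by
    rw [Complex.normSq_eq_norm_sq, Complex.normSq_eq_norm_sq, heq]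
  have hid : Complex.normSq (a + Complex.I * b) - Complex.normSq (conj a + Complex.I * conj b) =
      4 * (a.im * b.re - a.re * b.im) := by
    simp only [Complex.normSq_apply, Complex.add_re, Complex.add_im, Complex.mul_re, Complex.mul_im,
      Complex.I_re, Complex.I_im, Complex.conj_re, Complex.conj_im]
    ring
  have hW0 : (b * conj a).im = 0 := by
    have hW : (b * conj a).im = -(a.im * b.re - a.re * b.im) := by
      simp only [Complex.mul_im, Complex.conj_re, Complex.conj_im]
      ring
    rw [hW]
    linarith
  by_cases hGz : a = 0
  · exact (h.eq_zero_or_isRealStable_right.resolve_left hg) z hz hGz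
  · have key := eq_C_mul_of_im_eval_mul_conj_nonpos (u := f) (v := g) hGz
      (by
        filter_upwards [isOpen_upperHalfSpace.mem_nhds hz] with y hy
        exact h.im_eval_mul_conj_nonpos hy)
      hW0
    exact hfg _ key

/-- **Brändén 2007, Corollary 5.5.** Let `f = h + ig ≠ 0` with `h, g ∈ ℝ[z₁,…,zₙ]` and let `z_{n+1}` be a new
indeterminate. The following are equivalent: (a) `h + ig` is stable (i.e. `g ≪ h`); (b) `h + z_{n+1} g` is real
stable; (c) all nonzero polynomials of the pencil `{αh + βg}` are real stable and
`∂ⱼh(x)·g(x) − h(x)·∂ⱼg(x) ≥ 0` for all `j` and all `x ∈ ℝⁿ`. ((a) ⇔ (b) is Lemma 1.8 (1) ⇔ (3); (a) ⇒ (c) is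
Theorem 1.9; (c) ⇒ (a) is the tree's `eval_add_mul_eval_ne_zero` (`RealStableMultiaffineCriterion.lean`, the
form of (c) ⇒ (b) proved there for Theorem 5.6) at `z_{n+1} = i`, after disposing of `h = 0`.)
[cite: Branden2007, §5 Corollary 5.5] [cite: BorceaBranden2009, §1 Lemma 1.8 and Theorem 1.9] -/
theorem isProperPosition_tfae (h g : MvPolynomial σ ℝ) (hne : ¬(h = 0 ∧ g = 0)) :
    List.TFAE
      [ IsProperPosition g h,
        IsRealStable (rename some h + X none * rename some g : MvPolynomial (Option σ) ℝ),
        (∀ a b : ℝ, C a * h + C b * g = 0 ∨ IsRealStable (C a * h + C b * g)) ∧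
          ∀ (x : σ → ℝ) (j : σ), 0 ≤ eval x (pderiv j h * g - h * pderiv j g) ] := by
  tfae_have 1 ↔ 2 := isProperPosition_iff_isRealStable_add_X_mul g h
  tfae_have 1 → 3 := fun hp =>
    ⟨fun a b => (isRealStable_pencil_iff h g).2 (Or.inr (Or.inr hp)) a b, fun x j => hp.wronskian_nonneg x j⟩
  tfae_have 3 → 1 := by
    rintro ⟨hpencil, hW⟩
    have hh : h = 0 ∨ IsRealStable h := by simpa using hpencil 1 0
    have hg : g = 0 ∨ IsRealStable g := by simpa using hpencil 0 1
    rcases hh with hh0 | hhs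
    · subst hh0
      rw [isProperPosition_zero_right_iff]
      exact hg.resolve_left fun hg0 => hne ⟨rfl, hg0⟩
    · rw [isProperPosition_iff_forall]
      intro z hz
      exact eval_add_mul_eval_ne_zero hhs hg (fun γ => by simpa using hpencil 1 γ) hW hz (w := Complex.I)
        (by simp)
  tfae_finish

end LineStrictTFAE

end Literature.Combinatorics.StablePolynomials
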